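import Summits.CriticalPhenomena.CardyFormulaZ2.Theses.CardyOrderDuality
import Literature.Probability.RandomPlanarGeometry.ConformalRectangleProofs
import Summits.CriticalPhenomena.CardyFormulaZ2.Theorems.CardyAnchoredRigiditySubseqCardyReduction

/-!
# `CardyFormulaZ2 → UniformRefinementDominance` (the crux is a CONSEQUENCE of the summit)

Strategist r1 record (stmt-CriticalPhenomena-4715, 2026-08-17). The summit `S = CardyFormulaZ2`
gives, for every conformal rectangle `R` and every uniformizing datum `(φ, x)` (which EXISTS:
`MarkedDomain.exists_isUniformizing_holds`, proved in the tree from the Riemann mapping theorem +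
Carathéodory), `P^δ(R) → F(crossRatio x)` as `δ → 0⁺`; a convergent family is uniformly Cauchy
near `0⁺`, which is the one-sided uniform criterion `X_OD = UniformRefinementDominance`.
So `S → C` holds (C is the existence conjunct of S); the reverse `C → S` is the open content
(conformal covariance + identification), cf. the failing probe `UniformRefinementDominance_probe.lean`.

Also certified here: `C ↔ LimitExists` (the route's support item `UniformIffLimit`, by name) and the
CONJUNCT SPLIT `CardyFormulaZ2 ↔ C ∧ ConfInvTransport ∧ CardyRigidity` (`←` is the route's `closes`),
i.e. the three binders of the deciding theorem are jointly equivalent to the summit and each is one of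
its consequences. Nothing in this file proves an open item unconditionally except `uniformIffLimit_holds`.
-/

open Filter Set Topology
open Summit.CriticalPhenomena.CardyFormulaZ2.Theses.CardyOrderDuality

namespace Summit.CriticalPhenomena.CardyFormulaZ2.Cruxes.UniformRefinementDominance.Strategist

/-- Any family `p : ℝ → ℝ` converging as `δ → 0⁺` satisfies the uniform one-sided criterion. -/
theorem uniform_oneSided_of_tendsto {p : ℝ → ℝ} {L : ℝ}
    (h : Tendsto p (𝓝[>] (0 : ℝ)) (𝓝 L)) (ε : ℝ) (hε : 0 < ε) :
    ∃ δ₀ : ℝ, 0 < δ₀ ∧ ∀ δ δ' : ℝ, 0 < δ' → δ' ≤ δ → δ ≤ δ₀ → p δ' ≤ p δ + ε := by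
  have hε2 : 0 < ε / 2 := half_pos hε
  have hev : ∀ᶠ δ in 𝓝[>] (0 : ℝ), dist (p δ) L < ε / 2 :=
    (Metric.tendsto_nhds.1 h) (ε / 2) hε2
  obtain ⟨δ₀, hδ₀, hsub⟩ := mem_nhdsGT_iff_exists_Ioc_subset.1 hev
  refine ⟨δ₀, hδ₀, fun δ δ' hδ' hle hδle => ?_⟩
  have hδ : 0 < δ := lt_of_lt_of_le hδ' hle
  have h1 : dist (p δ') L < ε / 2 := hsub ⟨hδ', hle.trans hδle⟩
  have h2 : dist (p δ) L < ε / 2 := hsub ⟨hδ, hδle⟩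
  rw [Real.dist_eq] at h1 h2
  have h1' := (abs_lt.1 h1).2
  have h2' := (abs_lt.1 h2).1
  linarith

/-- **S → C.** Cardy's formula on `ℤ²` implies the crux `UniformRefinementDominance`
(sorry-free; inputs: `exists_isUniformizing_holds` and the definition of `HasCrossingLimit`). -/
theorem uniformRefinementDominance_of_cardyFormulaZ2 (hS : _root_.CardyFormulaZ2) :
    UniformRefinementDominance := by
  intro R ε hε
  obtain ⟨φ, x, hφx⟩ :=
    Literature.Probability.RandomPlanarGeometry.MarkedDomain.exists_isUniformizing_holds
      R
  have hlim := hS R φ x hφx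
  exact uniform_oneSided_of_tendsto hlim ε hε

/-- Hence also `S → LimitExists` (the shared support item stmt-CriticalPhenomena-0747). -/
theorem limitExists_of_cardyFormulaZ2 (hS : _root_.CardyFormulaZ2) : LimitExists := by
  intro R
  obtain ⟨φ, x, hφx⟩ :=
    Literature.Probability.RandomPlanarGeometry.MarkedDomain.exists_isUniformizing_holds
      R
  exact ⟨_, hS R φ x hφx⟩

/-- `LimitExists → C` (the Cauchy half of UniformIffLimit, item stmt-CriticalPhenomena-10539). -/
theorem uniformRefinementDominance_of_limitExists (hL : LimitExists) :
    UniformRefinementDominance := by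
  intro R ε hε
  obtain ⟨L, hlim⟩ := hL R
  exact uniform_oneSided_of_tendsto hlim ε hε

/-- `C → LimitExists` (the liminf/limsup half of UniformIffLimit; the same argument is the first
block of the route's deciding theorem `closes`). -/
theorem limitExists_of_uniformRefinementDominance (hU : UniformRefinementDominance) :
    LimitExists := by
  intro R
  have h01 : ∀ δ : ℝ,
      Literature.Probability.Percolation.bondDomainCrossingProb R δ ∈ Icc (0:ℝ) 1 :=
    fun δ => Literature.Probability.Percolation.bondDomainCrossingProb_mem_Icc R δ
  have hble : IsBoundedUnder (· ≤ ·) (𝓝[>] (0:ℝ))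
      (Literature.Probability.Percolation.bondDomainCrossingProb R) :=
    isBoundedUnder_of ⟨1, fun δ => (h01 δ).2⟩
  have hbge : IsBoundedUnder (· ≥ ·) (𝓝[>] (0:ℝ))
      (Literature.Probability.Percolation.bondDomainCrossingProb R) :=
    isBoundedUnder_of ⟨0, fun δ => (h01 δ).1⟩
  have hcle : IsCoboundedUnder (· ≤ ·) (𝓝[>] (0:ℝ))
      (Literature.Probability.Percolation.bondDomainCrossingProb R) := hbge.isCoboundedUnder_le
  have hcge : IsCoboundedUnder (· ≥ ·) (𝓝[>] (0:ℝ))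
      (Literature.Probability.Percolation.bondDomainCrossingProb R) := hble.isCoboundedUnder_ge
  refine ⟨liminf (Literature.Probability.Percolation.bondDomainCrossingProb R) (𝓝[>] 0),
    tendsto_of_le_liminf_of_limsup_le le_rfl ?_ hble hbge⟩
  refine le_of_forall_pos_le_add fun ε hε => ?_
  obtain ⟨δ₀, hδ₀, hdom⟩ := hU R (ε / 2) (half_pos hε)
  have hfreq : ∃ᶠ δ in 𝓝[>] (0:ℝ), Literature.Probability.Percolation.bondDomainCrossingProb R δ <
      liminf (Literature.Probability.Percolation.bondDomainCrossingProb R) (𝓝[>] 0) + ε / 2 :=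
    frequently_lt_of_liminf_lt hcge (by linarith)
  have hev : ∀ᶠ δ in 𝓝[>] (0:ℝ), δ ∈ Ioc (0:ℝ) δ₀ := Ioc_mem_nhdsGT hδ₀
  obtain ⟨δ, hpδ, hδpos, hδle⟩ := (hfreq.and_eventually hev).exists
  refine limsup_le_of_le hcle ?_
  filter_upwards [Ioc_mem_nhdsGT hδpos] with δ' hδ'
  have h1 := hdom δ δ' hδ'.1 hδ'.2 hδle
  linarith

/-- **C ↔ LimitExists**: the crux is the shared open item `LimitExists` (stmt-CriticalPhenomena-0747,
Bollobás–Riordan 2006 Ch. 7 Conj. 1 (existence clause); Schramm–Smirnov 2011 Question 2) in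
one-sided dress — elementary real analysis on `[0,1]`-valued families, both directions. -/
theorem uniformRefinementDominance_iff_limitExists : UniformRefinementDominance ↔ LimitExists :=
  ⟨limitExists_of_uniformRefinementDominance, uniformRefinementDominance_of_limitExists⟩

/-- The route's support item `UniformIffLimit` (stmt-CriticalPhenomena-10539) BY NAME. -/
theorem uniformIffLimit_holds : UniformIffLimit := uniformRefinementDominance_iff_limitExists

/-! ### Conjunct-split certificate: the three binders of `closes` are JOINTLY equivalent to `S` -/

/-- `S → ConfInvTransport` (stmt-CriticalPhenomena-0794): under Cardy's formula both rectangles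
converge to `F(η)`, and limits along `𝓝[>] 0` are unique. -/
theorem confInvTransport_of_cardyFormulaZ2 (hS : _root_.CardyFormulaZ2) : ConfInvTransport := by
  intro R R' φ x φ' x' hφ hφ' hη L hL
  have h1 := hS R φ x hφ
  have h2 := hS R' φ' x' hφ'
  have hLF : L = Literature.Probability.RandomPlanarGeometry.cardyFunction
      (Literature.Probability.RandomPlanarGeometry.crossRatio x) :=
    tendsto_nhds_unique hL h1
  rw [hLF, hη]
  exact h2

/-- `S → CardyRigidity` (stmt-CriticalPhenomena-0746): every `η ∈ (0,1)` is the modulus of some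
conformal rectangle (`exists_conformalRectangle_crossRatio_eq`, landed Theorems), whose crossing
probabilities converge both to `f η` and to `F η`. -/
theorem cardyRigidity_of_cardyFormulaZ2 (hS : _root_.CardyFormulaZ2) : CardyRigidity := by
  intro f hf η hη
  obtain ⟨R, φ, x, hφ, hcr⟩ :=
    Summit.CriticalPhenomena.CardyFormulaZ2.Cruxes.SubseqCardy.Birth.exists_conformalRectangle_crossRatio_eq hη
  have h1 := hf R φ x hφ
  have h2 := hS R φ x hφ
  rw [hcr] at h1 h2
  exact tendsto_nhds_unique h1 h2

/-- **Conjunct split, certified.** `CardyFormulaZ2 ↔ UniformRefinementDominance ∧ ConfInvTransport ∧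
CardyRigidity`: `←` is the route's deciding theorem `closes`; `→` is this file. Hence the crux
`UniformRefinementDominance` is the EXISTENCE conjunct of the summit, and the route's two shared cruxes
are the residual (conformal covariance + identification). -/
theorem cardyFormulaZ2_iff_conjuncts :
    _root_.CardyFormulaZ2 ↔ UniformRefinementDominance ∧ ConfInvTransport ∧ CardyRigidity :=
  ⟨fun hS => ⟨uniformRefinementDominance_of_cardyFormulaZ2 hS, confInvTransport_of_cardyFormulaZ2 hS,
      cardyRigidity_of_cardyFormulaZ2 hS⟩,
    fun h => closes h.1 h.2.1 h.2.2⟩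

end Summit.CriticalPhenomena.CardyFormulaZ2.Cruxes.UniformRefinementDominance.Strategist
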